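import Summits.BirchSwinnertonDyer.BirchSwinnertonDyer.Theorems.KolyvaginRoadThreeSchneiderTamAtThreeHeightLogNumeratorExactPSplitT
import Summits.BirchSwinnertonDyer.BirchSwinnertonDyer.Theorems.KolyvaginRoadThreeSchneiderTamAtThreeHeightLogNumeratorExactPSplitLaw
import HarnessLib

/-!
# «The height is the logarithm of the numerator» — part 8c: THE EXACT SPLIT ROW CHECKER at `p ≥ 5`
# (one congruence per pair; `RegMult.CertSplit W p Q 1`; regime `k + v_L ≤ ν`, `v_L ≤ 2k`)

HONEST FRAMING (cell `bsd-stepL`, seat `bsd-stepL-tam3-p2` g5, WIDTH-LEVER second lane «closed-form Schneider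
local factor … by Kodaira type (finite case table proved once)»; `--supports stmt-BirchSwinnertonDyer-19154 --as helper`):
THEOREMS ONLY; 0 definitions, 0 named facts, 0 sorry; ONE curve per application; nothing class-wide; Schneider's
conjecture and BSD asserted nowhere. Route-free. The split twin of parts 6/6b — the «deep (precision 4–5) split
checker» that `bsd-stepL-rest-p2` g7 named as the honest next construction for TR3, TR4, TR6–TR10 of crux 19624 and
for the (T) branch 19702 (every (T) pair is split with `5 ∣ ν`): the modified height
`ĥ^{split}(Q) = ĥ_{4.1}(Q) − λ_E·ℓ(Q)²`, `λ_E = C⁻²/log_p q_E`, is compared at precision `p^{4k}` with the RATIONAL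
`T_s = T − c̃·P₃(x⁻¹)/ℓ̃og`, where `T = M/((p−1)Lc₄⁴a)` is part 8a's rational for `ĥ_{4.1}`, `c̃ = −c₆(c₄³ + 744Δ)/c₄⁴`
(`≡ C⁻²` mod `q²`, part 8b), `P₃(t) = t − (b₂/12)t² + (b₂²/144 + c₄/240)t³` (`≡ ℓ²` mod `x⁻³`, part 8b) and
`ℓ̃og = SB/((p−1)L_B)` the truncated logarithm of the unit part of `q_E` read on the integer model (part 8b, g4's `U, N_L`).
`‖ĥ^{split} − T_s‖ ≤ p^{−4k}` when `k + v_L ≤ ν`, `v_L ≤ 2k`; so `p^{4k+d} ∤ M_s = T_s·Den` (`p^d ∥ Den`) certifies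
`ĥ^{split}(Q) ≠ 0` (`heightSplitCoord_ne_zero_of_exactSplitRow_padic`, `certSplit_of_exactSplitRow_padic`). Rows with
`k + v_L > ν` (TR7, TR8) need the third-order `1/j`-expansion of `q_E`, not in the tree. References: [SteinWuthrich2013] §4.2;
[SilvermanATAEC1994] V.3.1 (b), V.5.1; [SilvermanAEC2009] VII.2.1; [Iwasawa1972PadicL] §4.4; tree: parts 8a/8b, g4 `…Split`.
-/

noncomputable section

open scoped Classical
open IsUltrametricDist
open WeierstrassCurve Literature.NumberTheory.EllipticCurves
open Literature.NumberTheory.EllipticCurves.SteinWuthrich2013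
open Literature.NumberTheory.EllipticCurves.TateCurve
open Literature.NumberTheory.EllipticCurves.Rank1Residual
open Summit.BirchSwinnertonDyer.Uniform.UI.O2
open Summit.BirchSwinnertonDyer.Rank1Residual Summit.BirchSwinnertonDyer.Rank1Residual.X11b
open Summit.BirchSwinnertonDyer.BirchSwinnertonDyer.Rank1Residual

namespace Summit.BirchSwinnertonDyer.Rank1Residual.X11b.RegMult.HeightLogNumerator

variable {p : ℕ} [hp : Fact p.Prime]

section SplitChecker

set_option maxHeartbeats 1600000 in
/-- **THE EXACT SPLIT ROW CHECKER at `p ≥ 5` (value form).** Hypotheses: `H₁` = the (4.1) part (as part 6b / 8a, without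
its criterion); `H₂` = the split data on the integer model (`b₂`; `Δ = p^ν·D'`, `p ∤ D'`; g4's `U`, `N_L` with `p^{v_L} ∥ N_L`;
the regime `k + v_L ≤ ν`, `v_L ≤ 2k`; an integer `B` with `p^{2k+2v_L} ∣ N_L − B·c₄^{6(p−1)}`, `p^β ∣ B`, `1 ≤ β`,
`(N'+1)p^{2k+2v_L} ≤ p^{(N'+1)β}`; `SB = L_B·Σ_{n<N'}(−1)ⁿBⁿ⁺¹/(n+1)`; `Den = (p−1)·L·c₄⁴·a³·720·SB` with `p^d ∥ Den`;
**`p^{4k+d} ∤ M_s`**, `M_s = M·a²·720·SB + c₆(c₄³ + 744p^νD')(720a²E − 60b₂aE² + (5b₂² + 3c₄)E³)(p−1)²·L·L_B`,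
`E = (pᵏe')²`). Conclusion: `heightSplitCoord W p q x y ≠ 0` for THE Tate parameter (`q ≠ 0`, `‖q‖ < 1`, `tateJ q = j`).
ONE curve per application; every hypothesis decided by `decide`/`norm_num`. [cite: SteinWuthrich2013, §4.2]
[cite: SilvermanATAEC1994, Lemma V.5.1] [cite: Iwasawa1972PadicL, §4.4] -/
theorem heightSplitCoord_ne_zero_of_exactSplitRow_padic (hp5 : 5 ≤ p) (W : WeierstrassCurve ℚ) {a₁ a₂ a₃ a₄ a₆ : ℤ}
    (hW : W = ⟨a₁, a₂, a₃, a₄, a₆⟩) [W.IsElliptic] [W.IsGloballyMinimal] (hWm : Mult W p)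
    {a c4 c6 D κn A SL L M b2 Dp U NL B SB LB Den Ms : ℤ} {e' k N α w ν vL β N' d : ℕ}
    (H₁ : ¬ p ∣ e' ∧ 1 ≤ k ∧ Nat.Coprime a.natAbs (p ^ k * e') ∧
      c4 = (a₁ ^ 2 + 4 * a₂) ^ 2 - 24 * (2 * a₄ + a₁ * a₃) ∧
      c6 = -(a₁ ^ 2 + 4 * a₂) ^ 3 + 36 * (a₁ ^ 2 + 4 * a₂) * (2 * a₄ + a₁ * a₃) - 216 * (a₃ ^ 2 + 4 * a₆) ∧
      D = -(a₁ ^ 2 + 4 * a₂) ^ 2 * (a₁ ^ 2 * a₆ + 4 * a₂ * a₆ - a₁ * a₃ * a₄ + a₂ * a₃ ^ 2 - a₄ ^ 2) -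
        8 * (2 * a₄ + a₁ * a₃) ^ 3 - 27 * (a₃ ^ 2 + 4 * a₆) ^ 2 +
        9 * (a₁ ^ 2 + 4 * a₂) * (2 * a₄ + a₁ * a₃) * (a₃ ^ 2 + 4 * a₆) ∧
      ¬ (p : ℤ) ∣ c4 ∧ (p : ℤ) ^ k ∣ D ∧
      κn = ((a₁ ^ 2 + 4 * a₂) * (2 * a₄ + a₁ * a₃) - 18 * (a₃ ^ 2 + 4 * a₆)) * c4 ^ 3 + 60 * c6 * D ∧
      (p : ℤ) ^ (4 * k) ∣ a ^ (p - 1) - 1 - A ∧ (p : ℤ) ^ α ∣ A ∧ 1 ≤ α ∧ (N + 1) * p ^ (4 * k) ≤ p ^ ((N + 1) * α) ∧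
      (p : ℤ) ^ w ∣ L ∧ ¬ (p : ℤ) ^ (w + 1) ∣ L ∧
      M = c4 ^ 4 * a * SL + (p - 1 : ℕ) * L * κn * ((p ^ k * e' : ℕ) : ℤ) ^ 2)
    (hSL : (SL : ℚ) = L * ∑ n ∈ Finset.range N, (-1) ^ n * (A : ℚ) ^ (n + 1) / ((n : ℚ) + 1))
    (H₂ : b2 = a₁ ^ 2 + 4 * a₂ ∧ (p : ℤ) ^ ν * Dp = D ∧ ¬ (p : ℤ) ∣ Dp ∧
      U = Dp * c4 ^ 3 + 744 * (p : ℤ) ^ ν * Dp ^ 2 ∧ NL = U ^ (p - 1) - c4 ^ (6 * (p - 1)) ∧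
      (p : ℤ) ^ vL ∣ NL ∧ ¬ (p : ℤ) ^ (vL + 1) ∣ NL ∧ k + vL ≤ ν ∧ vL ≤ 2 * k ∧
      (p : ℤ) ^ (2 * k + 2 * vL) ∣ NL - B * c4 ^ (6 * (p - 1)) ∧ (p : ℤ) ^ β ∣ B ∧ 1 ≤ β ∧
      (N' + 1) * p ^ (2 * k + 2 * vL) ≤ p ^ ((N' + 1) * β) ∧
      Den = (p - 1 : ℕ) * L * c4 ^ 4 * a ^ 3 * 720 * SB ∧ (p : ℤ) ^ d ∣ Den ∧ ¬ (p : ℤ) ^ (d + 1) ∣ Den ∧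
      Ms = M * a ^ 2 * 720 * SB + c6 * (c4 ^ 3 + 744 * (p : ℤ) ^ ν * Dp) *
        (720 * a ^ 2 * ((p ^ k * e' : ℕ) : ℤ) ^ 2 - 60 * b2 * a * ((p ^ k * e' : ℕ) : ℤ) ^ 4 +
          (5 * b2 ^ 2 + 3 * c4) * ((p ^ k * e' : ℕ) : ℤ) ^ 6) * (p - 1 : ℕ) ^ 2 * L * LB ∧
      ¬ (p : ℤ) ^ (4 * k + d) ∣ Ms)
    (hSB : (SB : ℚ) = LB * ∑ n ∈ Finset.range N', (-1) ^ n * (B : ℚ) ^ (n + 1) / ((n : ℚ) + 1))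
    {x y : ℚ} (hx : x = a / ((p ^ k * e' : ℕ) : ℚ) ^ 2) (hP : W.toAffine.Equation x y)
    {q : ℚ_[p]} (hq0 : q ≠ 0) (hq : ‖q‖ < 1) (hj : tateJ q = (W.j : ℚ_[p])) :
    heightSplitCoord W p q x y ≠ 0 := by
  -- (0) the (4.1) part: `‖ĥ₄.₁ − T‖ ≤ p^{−4k}`
  obtain ⟨hT, hDen1, hDen10⟩ := norm_heightFourOneCoord_sub_exactT_le_padic hp5 W hW hWm H₁ hSL hx hP hq hj
  obtain ⟨hpe', hk, hcop, hc4, hc6, hD, hpc4, hkD, -, -, -, -, -, hwL, hwL', -⟩ := H₁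
  obtain ⟨hb2, hDp, hpDp, hU, hNL, hvL1, hvL2, hkvν, hvL2k, hBc, hβB, hβ1, hN'β, hDen, hdD, hdD', hMs, hcrit⟩ := H₂
  have hpP : p.Prime := Fact.out
  have hp2 : p ≠ 2 := by omega
  have hp3 : p ≠ 3 := by omega
  have hp1 : (1 : ℝ) < p := by exact_mod_cast hpP.one_lt
  have hp1' : (1 : ℝ) ≤ p := hp1.le
  have hpR0 : (0 : ℝ) < p := by positivity
  have hLn : ‖(L : ℚ_[p])‖ = (p : ℝ) ^ (-(w : ℤ)) := GaloisImage.PadicSquareClass.norm_intCast_padic_eq hwL hwL'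
  have hL0 : (L : ℚ_[p]) ≠ 0 := norm_pos_iff.mp (by rw [hLn]; positivity)
  set T : ℚ_[p] := (M : ℚ_[p]) / (((p : ℚ_[p]) - 1) * (L : ℚ_[p]) * (c4 : ℚ_[p]) ^ 4 * (a : ℚ_[p])) with hTdef
  -- basic facts about the point
  have he'0 : e' ≠ 0 := by rintro rfl; exact hpe' (dvd_zero p)
  have he0 : (p ^ k * e' : ℕ) ≠ 0 := Nat.mul_ne_zero (pow_ne_zero _ hpP.ne_zero) he'0
  have hpe : p ∣ p ^ k * e' := dvd_mul_of_dvd_left (dvd_pow_self p (by omega)) _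
  have h : W.toAffine.Nonsingular x y :=
    (WeierstrassCurve.Affine.equation_iff_nonsingular (W := W.toAffine)).mp hP
  have hx1 : 1 < ‖(x : ℚ_[p])‖ :=
    (one_lt_norm_ratCast_iff p x).mpr (KernelCert.padicValRat_x_neg he0 hx hcop hpe)
  obtain ⟨hz, hz2⟩ := norm_neg_div_of_one_lt_norm (p := p) h hx1
  have hpa : ¬ (p : ℤ) ∣ a := by
    intro hd
    have h1' : p ∣ a.natAbs := Int.natCast_dvd.mp hd
    have h2' : p ∣ Nat.gcd a.natAbs (p ^ k * e') := Nat.dvd_gcd h1' hpe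
    rw [hcop] at h2'
    exact hpP.one_lt.ne' (Nat.dvd_one.mp h2')
  have han : ‖(a : ℚ_[p])‖ = 1 := BinaryQuartic.norm_intCast_eq_one hpa
  have ha0 : (a : ℚ_[p]) ≠ 0 := norm_pos_iff.mp (by rw [han]; exact one_pos)
  have hc4n : ‖(c4 : ℚ_[p])‖ = 1 := BinaryQuartic.norm_intCast_eq_one hpc4
  have hc40 : (c4 : ℚ_[p]) ≠ 0 := norm_pos_iff.mp (by rw [hc4n]; exact one_pos)
  have hc6int : ‖(c6 : ℚ_[p])‖ ≤ 1 := Padic.norm_int_le_one _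
  have he'n : ‖(e' : ℚ_[p])‖ = 1 := by
    rw [show (e' : ℚ_[p]) = ((e' : ℤ) : ℚ_[p]) by norm_cast]
    exact BinaryQuartic.norm_intCast_eq_one (fun hd => hpe' (by exact_mod_cast hd))
  have he'0Q : (e' : ℚ_[p]) ≠ 0 := by exact_mod_cast he'0
  have hpQ : (p : ℚ_[p]) ≠ 0 := by exact_mod_cast hpP.ne_zero
  have hxp : (x : ℚ_[p]) = (a : ℚ_[p]) / ((p : ℚ_[p]) ^ k * (e' : ℚ_[p])) ^ 2 := by
    rw [hx]; push_cast; ring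
  have hxinv : ‖(x : ℚ_[p])‖⁻¹ = (p : ℝ) ^ (-((2 * k : ℕ) : ℤ)) := by
    rw [hxp, norm_div, han, norm_pow, norm_mul, norm_pow, Padic.norm_p, he'n,
      mul_one, one_div, inv_inv, ← zpow_natCast, ← zpow_natCast, ← zpow_mul, inv_zpow']
    congr 1; push_cast; ring
  have hX0 : (x : ℚ_[p]) ≠ 0 := norm_pos_iff.mp (one_pos.trans hx1)
  set V := W.baseChange ℚ_[p] with hVdef
  have heq : V.toAffine.Equation (x : ℚ_[p]) (y : ℚ_[p]) := (nonsingular_ratCast (p := p) h).left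
  -- the curve data in `ℚ_p`
  have hVb2 : V.b₂ = (b2 : ℚ_[p]) := by
    have h1 : V.b₂ = ((W.b₂ : ℚ) : ℚ_[p]) := (map_b₂ W (algebraMap ℚ ℚ_[p])).trans (eq_ratCast _ _)
    rw [h1, hb2]; subst hW; simp only [WeierstrassCurve.b₂]; push_cast; ring
  have hWc4Q : W.c₄ = (c4 : ℚ) := by
    subst hW; rw [hc4]; simp only [WeierstrassCurve.c₄, WeierstrassCurve.b₂, WeierstrassCurve.b₄]; push_cast; ring
  have hWc6Q : W.c₆ = (c6 : ℚ) := by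
    subst hW; rw [hc6]
    simp only [WeierstrassCurve.c₆, WeierstrassCurve.b₂, WeierstrassCurve.b₄, WeierstrassCurve.b₆]; push_cast; ring
  have hWc4 : (W.c₄ : ℚ_[p]) = (c4 : ℚ_[p]) := by rw [hWc4Q]; push_cast; rfl
  have hWc6 : (W.c₆ : ℚ_[p]) = (c6 : ℚ_[p]) := by rw [hWc6Q]; push_cast; rfl
  have hVc4 : V.c₄ = (c4 : ℚ_[p]) := by
    have h1 : V.c₄ = ((W.c₄ : ℚ) : ℚ_[p]) := (map_c₄ W (algebraMap ℚ ℚ_[p])).trans (eq_ratCast _ _)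
    rw [h1, hWc4Q]; push_cast; rfl
  have hjinv : ((W.j : ℚ_[p]))⁻¹ = (p : ℚ_[p]) ^ ν * (Dp : ℚ_[p]) / (c4 : ℚ_[p]) ^ 3 := by
    rw [ratCast_j_inv_eq_padic (p := p) W hW hc4 (hDp.trans hD)]; push_cast; ring
  -- (1) `ℓ² ≈ P₃(x⁻¹)` (part 8b §21)
  set ℓ : ℚ_[p] := V.padicFormalLog (-(x : ℚ_[p]) / y) with hℓdef
  set P3 : ℚ_[p] := ((x : ℚ_[p]))⁻¹ - (b2 : ℚ_[p]) / 12 * ((x : ℚ_[p]))⁻¹ ^ 2 +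
    ((b2 : ℚ_[p]) ^ 2 / 144 + (c4 : ℚ_[p]) / 240) * ((x : ℚ_[p]))⁻¹ ^ 3 with hP3def
  have hℓP : ‖ℓ ^ 2 - P3‖ ≤ (p : ℝ) ^ (-((6 * k : ℕ) : ℤ)) := by
    have h1 := norm_formalLog_sq_sub_cubicProxy_le_padic V hp5 heq hx1 hz
    rw [hVb2, hVc4, hxinv] at h1
    refine h1.trans_eq ?_
    rw [← zpow_natCast, ← zpow_mul]; congr 1; push_cast; ring
  -- (2) `C⁻² ≈ c̃` (part 8b §22)
  set C2 : ℚ_[p] := uniformisationScaleSq W p q with hC2def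
  set ct : ℚ_[p] := -((c6 : ℚ_[p]) / (c4 : ℚ_[p]) * (1 + 744 * ((p : ℚ_[p]) ^ ν * (Dp : ℚ_[p]) / (c4 : ℚ_[p]) ^ 3)))
    with hctdef
  have hCct : ‖C2⁻¹ - ct‖ ≤ ‖q‖ ^ 2 := by
    have h1 := norm_inv_uniformisationScaleSq_add_j_le_padic hWm hq hj
    rw [hWc4, hWc6, hjinv] at h1
    rw [hctdef, sub_neg_eq_add]; exact h1
  have hctn : ‖ct‖ ≤ 1 := by
    rw [hctdef, norm_neg, norm_mul, norm_div, hc4n, div_one]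
    have h744 : ‖(744 : ℚ_[p])‖ ≤ 1 := by exact_mod_cast Padic.norm_int_le_one (p := p) 744
    have hin : ‖1 + 744 * ((p : ℚ_[p]) ^ ν * (Dp : ℚ_[p]) / (c4 : ℚ_[p]) ^ 3)‖ ≤ 1 := by
      refine (norm_add_le_max _ _).trans (max_le (by rw [norm_one]) ?_)
      rw [norm_mul, norm_div, norm_mul, norm_pow, norm_pow, hc4n, one_pow, div_one, Padic.norm_p]
      calc ‖(744 : ℚ_[p])‖ * (((p : ℝ)⁻¹) ^ ν * ‖(Dp : ℚ_[p])‖) ≤ 1 * (1 ^ ν * 1) := by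
            gcongr
            · exact inv_le_one_of_one_le₀ hp1'
            · exact Padic.norm_int_le_one _
        _ = 1 := by ring
    calc ‖(c6 : ℚ_[p])‖ * _ ≤ 1 * 1 := mul_le_mul hc6int hin (norm_nonneg _) zero_le_one
      _ = 1 := one_mul _
  -- (3) `log_p q`: its norm (g4) and its truncation (part 8b §23)
  have hLq : ‖padicLog p q‖ = (p : ℝ) ^ (-(vL : ℤ)) :=
    norm_padicLog_tateParam_eq_of_model hp2 W hW hc4 (hDp.trans hD) hpc4 hpDp hU hNL hvL1 hvL2 (by omega) hq0 hq hj
  have hLq0 : padicLog p q ≠ 0 := norm_pos_iff.mp (by rw [hLq]; positivity)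
  have hBn : ‖(B : ℚ_[p])‖ ≤ (p : ℝ) ^ (-(β : ℤ)) := by exact_mod_cast (Padic.norm_int_le_pow_iff_dvd B β).mpr hβB
  have hBp : ‖(B : ℚ_[p])‖ ≤ (p : ℝ)⁻¹ := hBn.trans (by rw [← zpow_neg_one]; exact zpow_le_zpow_right₀ hp1' (by omega))
  have htr := norm_padicLog_tateParam_sub_trunc_le_padic hp5 W hW hc4 (hDp.trans hD) hpc4 hpDp hU hNL hBp N' hq0 hq hj
  -- the rational `ℓ̃og = (p−1)⁻¹ · SB/LB` and its distance to `log_p q`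
  have hp1n : ‖((p : ℚ_[p]) - 1)‖ = 1 := by
    rw [show (p : ℚ_[p]) - 1 = ((p - 1 : ℕ) : ℚ_[p]) by rw [Nat.cast_sub hpP.one_le, Nat.cast_one]]
    exact Padic.norm_natCast_eq_one_iff.mpr ((Nat.coprime_self_sub_right hpP.one_le).mpr (Nat.coprime_one_right _))
  have hp10 : (p : ℚ_[p]) - 1 ≠ 0 := norm_pos_iff.mp (by rw [hp1n]; exact one_pos)
  have hDenn : ‖(Den : ℚ_[p])‖ = (p : ℝ) ^ (-(d : ℤ)) := GaloisImage.PadicSquareClass.norm_intCast_padic_eq hdD hdD'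
  have hDen0 : (Den : ℚ_[p]) ≠ 0 := norm_pos_iff.mp (by rw [hDenn]; positivity)
  have hSB0 : (SB : ℚ_[p]) ≠ 0 := by
    intro h0; apply hDen0; rw [hDen]; push_cast; rw [h0]; ring
  have hLB0 : (LB : ℚ_[p]) ≠ 0 := by
    intro h0; apply hSB0
    have hc := congrArg (fun t : ℚ => (t : ℚ_[p])) hSB
    simp only [Rat.cast_mul, Rat.cast_intCast] at hc
    rw [hc, h0, zero_mul]
  have hSBp : ∑ n ∈ Finset.range N', (-1) ^ n * ((B : ℚ_[p])) ^ (n + 1) / ((n : ℚ_[p]) + 1) =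
      (SB : ℚ_[p]) / (LB : ℚ_[p]) := by
    have hc := congrArg (fun t : ℚ => (t : ℚ_[p])) hSB
    have hc' : ((SB : ℚ_[p])) = (LB : ℚ_[p]) *
        ∑ n ∈ Finset.range N', (-1) ^ n * ((B : ℚ_[p])) ^ (n + 1) / ((n : ℚ_[p]) + 1) := by
      simpa [Rat.cast_sum] using hc
    rw [hc']; field_simp
  set lg : ℚ_[p] := ((p : ℚ_[p]) - 1)⁻¹ * ((SB : ℚ_[p]) / (LB : ℚ_[p])) with hlgdef
  rw [hSBp] at htr
  have h22 : ((p : ℝ) ^ (-((2 * k + 2 * vL : ℕ) : ℤ))) < (p : ℝ) ^ (-(vL : ℤ)) :=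
    zpow_lt_zpow_right₀ hp1 (by push_cast; omega)
  -- `‖q‖ = p^{−ν}`
  have hpn : ‖(p : ℚ_[p]) ^ ν‖ = (p : ℝ) ^ (-(ν : ℤ)) := by rw [norm_pow, Padic.norm_p, ← zpow_natCast, inv_zpow']
  have hDpn : ‖(Dp : ℚ_[p])‖ = 1 := BinaryQuartic.norm_intCast_eq_one hpDp
  have hqn : ‖q‖ = (p : ℝ) ^ (-(ν : ℤ)) := by
    rw [← inv_inv ‖q‖, ← norm_tateJ_eq hq, ← norm_inv, hj, hjinv, norm_div, norm_mul, hpn, norm_pow, hc4n, hDpn,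
      one_pow, div_one, mul_one]
  have hLl : ‖padicLog p q - lg‖ ≤ (p : ℝ) ^ (-((2 * k + 2 * vL : ℕ) : ℤ)) := by
    refine htr.trans (max_le (max_le ?_ ?_) ?_)
    · rw [hqn, ← zpow_natCast, ← zpow_mul]
      exact zpow_le_zpow_right₀ hp1' (by push_cast; omega)
    · rw [show (NL : ℚ_[p]) / (c4 : ℚ_[p]) ^ (6 * (p - 1)) - (B : ℚ_[p]) =
          ((NL - B * c4 ^ (6 * (p - 1)) : ℤ) : ℚ_[p]) / (c4 : ℚ_[p]) ^ (6 * (p - 1)) by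
            push_cast; field_simp, norm_div, norm_pow, hc4n, one_pow, div_one]
      exact_mod_cast (Padic.norm_int_le_pow_iff_dvd (NL - B * c4 ^ (6 * (p - 1))) (2 * k + 2 * vL)).mpr hBc
    · have key : ((N' : ℝ) + 1) * ((p : ℝ) ^ ((N' + 1) * β))⁻¹ ≤ ((p : ℝ) ^ (2 * k + 2 * vL))⁻¹ := by
        rw [mul_inv_le_iff₀ (by positivity), inv_mul_eq_div, le_div_iff₀ (by positivity)]
        exact_mod_cast hN'β
      calc ((N' : ℝ) + 1) * ‖(B : ℚ_[p])‖ ^ (N' + 1) ≤ ((N' : ℝ) + 1) * ((p : ℝ) ^ (-(β : ℤ))) ^ (N' + 1) := by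
            gcongr
        _ = ((N' : ℝ) + 1) * ((p : ℝ) ^ ((N' + 1) * β))⁻¹ := by
            rw [zpow_neg, zpow_natCast, inv_pow, ← pow_mul, mul_comm β]
        _ ≤ ((p : ℝ) ^ (2 * k + 2 * vL))⁻¹ := key
        _ = (p : ℝ) ^ (-((2 * k + 2 * vL : ℕ) : ℤ)) := by rw [zpow_neg, zpow_natCast]
  have hlt : ‖padicLog p q - lg‖ < ‖padicLog p q‖ := by rw [hLq]; exact hLl.trans_lt h22
  have hlgn : ‖lg‖ = (p : ℝ) ^ (-(vL : ℤ)) := by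
    rw [← hLq, show lg = padicLog p q + -(padicLog p q - lg) by ring,
      norm_add_eq_max_of_norm_ne_norm (by rw [norm_neg]; exact hlt.ne'), norm_neg, max_eq_left hlt.le]
  have hlg0 : lg ≠ 0 := norm_pos_iff.mp (by rw [hlgn]; positivity)
  have hinvdiff : ‖(padicLog p q)⁻¹ - lg⁻¹‖ ≤ (p : ℝ) ^ (-((2 * k : ℕ) : ℤ)) := by
    rw [inv_sub_inv hLq0 hlg0, norm_div, norm_mul, hLq, hlgn, norm_sub_rev, ← zpow_add₀ hpR0.ne']
    rw [div_le_iff₀ (by positivity)]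
    refine hLl.trans ?_
    rw [← zpow_add₀ hpR0.ne']; apply le_of_eq; congr 1; push_cast; ring
  have hz1 : ‖-(x : ℚ_[p]) / y‖ ≤ 1 := hz.trans (inv_le_one_of_one_le₀ hp1')
  have hℓn : ‖ℓ‖ ≤ ‖-(x : ℚ_[p]) / y‖ := by
    have hℓz : ‖ℓ - -(x : ℚ_[p]) / y‖ ≤ ‖-(x : ℚ_[p]) / y‖ ^ 2 := norm_padicFormalLog_sub_self_le_sq_padic V hp5 hz
    rw [show ℓ = (ℓ - -(x : ℚ_[p]) / y) + -(x : ℚ_[p]) / y by ring]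
    refine (norm_add_le_max _ _).trans (max_le (hℓz.trans ?_) le_rfl)
    calc ‖-(x : ℚ_[p]) / y‖ ^ 2 = ‖-(x : ℚ_[p]) / y‖ * ‖-(x : ℚ_[p]) / y‖ := sq _
      _ ≤ 1 * ‖-(x : ℚ_[p]) / y‖ := by gcongr
      _ = _ := one_mul _
  have hℓ2 : ‖ℓ ^ 2‖ ≤ (p : ℝ) ^ (-((2 * k : ℕ) : ℤ)) := by
    rw [norm_pow, ← hxinv, ← hz2]; exact pow_le_pow_left₀ (norm_nonneg _) hℓn 2
  have hunit : ∀ m : ℕ, Nat.Coprime p m → ‖((m : ℚ_[p]))⁻¹‖ = 1 := fun m hm => by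
    rw [norm_inv, Padic.norm_natCast_eq_one_iff.mpr hm, inv_one]
  have hcop2 : Nat.Coprime p 2 := (Nat.coprime_primes hp.out Nat.prime_two).mpr hp2
  have hcop3 : Nat.Coprime p 3 := (Nat.coprime_primes hp.out Nat.prime_three).mpr hp3
  have h12i : ‖(12 : ℚ_[p])⁻¹‖ = 1 := by
    have h12 : Nat.Coprime p 12 := by
      rw [show (12 : ℕ) = 2 ^ 2 * 3 by norm_num]; exact (Nat.Coprime.pow_right 2 hcop2).mul_right hcop3
    simpa using hunit 12 h12
  have h144i : ‖(144 : ℚ_[p])⁻¹‖ = 1 := by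
    have h144 : Nat.Coprime p 144 := by
      rw [show (144 : ℕ) = 2 ^ 4 * 3 ^ 2 by norm_num]
      exact (Nat.Coprime.pow_right 4 hcop2).mul_right (Nat.Coprime.pow_right 2 hcop3)
    simpa using hunit 144 h144
  have h240 : ‖(240 : ℚ_[p])⁻¹‖ ≤ p := by
    have h := norm_inv_smooth_le_padic hp5 4 1 1; norm_num at h; rw [norm_inv]; exact h
  have hb2n : ‖(b2 : ℚ_[p])‖ ≤ 1 := Padic.norm_int_le_one _
  have hXi : ‖((x : ℚ_[p]))⁻¹‖ = (p : ℝ) ^ (-((2 * k : ℕ) : ℤ)) := by rw [norm_inv, hxinv]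
  have hp2k1 : (p : ℝ) ^ (-((2 * k : ℕ) : ℤ)) ≤ 1 := zpow_le_one_of_nonpos₀ hp1' (by simp)
  have hP3n : ‖P3‖ ≤ (p : ℝ) ^ (-((2 * k : ℕ) : ℤ)) := by
    rw [hP3def]
    refine (norm_add_le_max _ _).trans (max_le ((norm_sub_le_max₃ _ _).trans (max_le hXi.le ?_)) ?_)
    · rw [norm_mul, div_eq_mul_inv, norm_mul, h12i, mul_one, norm_pow, hXi]
      calc ‖(b2 : ℚ_[p])‖ * ((p : ℝ) ^ (-((2 * k : ℕ) : ℤ))) ^ 2 ≤ 1 * ((p : ℝ) ^ (-((2 * k : ℕ) : ℤ))) ^ 2 := by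
            gcongr
        _ = (p : ℝ) ^ (-((2 * k : ℕ) : ℤ)) * (p : ℝ) ^ (-((2 * k : ℕ) : ℤ)) := by ring
        _ ≤ (p : ℝ) ^ (-((2 * k : ℕ) : ℤ)) * 1 := by gcongr
        _ = _ := mul_one _
    · rw [norm_mul, norm_pow, hXi]
      have hco : ‖(b2 : ℚ_[p]) ^ 2 / 144 + (c4 : ℚ_[p]) / 240‖ ≤ p := by
        refine (norm_add_le_max _ _).trans (max_le ?_ ?_)
        · rw [div_eq_mul_inv, norm_mul, h144i, mul_one, norm_pow]
          exact (pow_le_one₀ (norm_nonneg _) hb2n).trans hp1'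
        · rw [div_eq_mul_inv, norm_mul, hc4n, one_mul]; exact h240
      have hpk : (p : ℝ) * (p : ℝ) ^ (-((2 * k : ℕ) : ℤ)) ≤ 1 := by
        rw [show (p : ℝ) * (p : ℝ) ^ (-((2 * k : ℕ) : ℤ)) = (p : ℝ) ^ (1 + -((2 * k : ℕ) : ℤ)) by
          rw [zpow_add₀ hpR0.ne', zpow_one]]
        exact zpow_le_one_of_nonpos₀ hp1' (by push_cast; omega)
      calc ‖(b2 : ℚ_[p]) ^ 2 / 144 + (c4 : ℚ_[p]) / 240‖ * ((p : ℝ) ^ (-((2 * k : ℕ) : ℤ))) ^ 3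
          ≤ p * ((p : ℝ) ^ (-((2 * k : ℕ) : ℤ))) ^ 3 := by gcongr
        _ = ((p : ℝ) * (p : ℝ) ^ (-((2 * k : ℕ) : ℤ))) * (p : ℝ) ^ (-((2 * k : ℕ) : ℤ)) *
              (p : ℝ) ^ (-((2 * k : ℕ) : ℤ)) := by ring
        _ ≤ 1 * 1 * (p : ℝ) ^ (-((2 * k : ℕ) : ℤ)) := by gcongr
        _ = _ := by ring
  set Ts : ℚ_[p] := T - ct * P3 / lg with hTsdef
  have hsplit : heightSplitCoord W p q x y = heightFourOneCoord W p q x y - C2⁻¹ * ℓ ^ 2 / padicLog p q := by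
    rw [heightSplitCoord_eq_sub]
    show heightFourOneCoord W p q x y - ℓ ^ 2 / C2 / padicLog p q = _
    rw [div_eq_mul_inv (ℓ ^ 2) C2, mul_comm (ℓ ^ 2)]
  have hdec : heightSplitCoord W p q x y - Ts = (heightFourOneCoord W p q x y - T) -
      ((C2⁻¹ - ct) * ℓ ^ 2 * (padicLog p q)⁻¹ + ct * (ℓ ^ 2 - P3) * (padicLog p q)⁻¹ +
        ct * P3 * ((padicLog p q)⁻¹ - lg⁻¹)) := by
    rw [hsplit, hTsdef, div_eq_mul_inv, div_eq_mul_inv]; ring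
  have h4k : ((p : ℝ) ^ (-((2 * k : ℕ) : ℤ))) ^ 2 = (p : ℝ) ^ (-((4 * k : ℕ) : ℤ)) := by
    rw [← zpow_natCast, ← zpow_mul]; congr 1; push_cast; ring
  have hLqi : ‖(padicLog p q)⁻¹‖ = (p : ℝ) ^ (vL : ℤ) := by rw [norm_inv, hLq, zpow_neg, inv_inv]
  have hdiff : ‖heightSplitCoord W p q x y - Ts‖ ≤ (p : ℝ) ^ (-((4 * k : ℕ) : ℤ)) := by
    rw [hdec]
    refine (norm_sub_le_max₃ _ _).trans (max_le hT ((norm_add_le_max _ _).trans (max_le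
      ((norm_add_le_max _ _).trans (max_le ?_ ?_)) ?_)))
    · rw [norm_mul, norm_mul, hLqi]
      calc ‖C2⁻¹ - ct‖ * ‖ℓ ^ 2‖ * (p : ℝ) ^ (vL : ℤ)
          ≤ ‖q‖ ^ 2 * (p : ℝ) ^ (-((2 * k : ℕ) : ℤ)) * (p : ℝ) ^ (vL : ℤ) := by gcongr
        _ = (p : ℝ) ^ (2 * (-(ν : ℤ)) + -((2 * k : ℕ) : ℤ) + (vL : ℤ)) := by
            rw [hqn, ← zpow_natCast, ← zpow_mul, ← zpow_add₀ hpR0.ne', ← zpow_add₀ hpR0.ne']; ring_nf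
        _ ≤ (p : ℝ) ^ (-((4 * k : ℕ) : ℤ)) := zpow_le_zpow_right₀ hp1' (by push_cast; omega)
    · rw [norm_mul, norm_mul, hLqi]
      calc ‖ct‖ * ‖ℓ ^ 2 - P3‖ * (p : ℝ) ^ (vL : ℤ) ≤ 1 * (p : ℝ) ^ (-((6 * k : ℕ) : ℤ)) * (p : ℝ) ^ (vL : ℤ) := by
            gcongr
        _ = (p : ℝ) ^ (-((6 * k : ℕ) : ℤ) + (vL : ℤ)) := by rw [one_mul, ← zpow_add₀ hpR0.ne']
        _ ≤ (p : ℝ) ^ (-((4 * k : ℕ) : ℤ)) := zpow_le_zpow_right₀ hp1' (by push_cast; omega)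
    · rw [norm_mul, norm_mul]
      calc ‖ct‖ * ‖P3‖ * ‖(padicLog p q)⁻¹ - lg⁻¹‖
          ≤ 1 * (p : ℝ) ^ (-((2 * k : ℕ) : ℤ)) * (p : ℝ) ^ (-((2 * k : ℕ) : ℤ)) := by gcongr
        _ = (p : ℝ) ^ (-((4 * k : ℕ) : ℤ)) := by rw [one_mul, ← sq, h4k]
  have hTsM : Ts * (Den : ℚ_[p]) = (Ms : ℚ_[p]) := by
    rw [hTsdef, hTdef, hctdef, hP3def, hlgdef, hDen, hMs, hxp]; push_cast
    rw [Nat.cast_sub hpP.one_le, Nat.cast_one]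
    field_simp
    ring
  have hTsn : ‖Ts‖ = ‖(Ms : ℚ_[p])‖ * (p : ℝ) ^ (d : ℤ) := by
    have eT : Ts = (Ms : ℚ_[p]) / (Den : ℚ_[p]) := by rw [← hTsM, mul_div_cancel_right₀ _ hDen0]
    rw [eT, norm_div, hDenn, zpow_neg, div_inv_eq_mul]
  have hMgt : (p : ℝ) ^ (-((4 * k + d : ℕ) : ℤ)) < ‖(Ms : ℚ_[p])‖ := by
    by_contra hle
    exact hcrit ((Padic.norm_int_le_pow_iff_dvd Ms (4 * k + d)).mp (not_lt.mp hle))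
  have hTgt : (p : ℝ) ^ (-((4 * k : ℕ) : ℤ)) < ‖Ts‖ := by
    rw [hTsn]
    calc (p : ℝ) ^ (-((4 * k : ℕ) : ℤ)) = (p : ℝ) ^ (-((4 * k + d : ℕ) : ℤ)) * (p : ℝ) ^ (d : ℤ) := by
          rw [← zpow_add₀ hpR0.ne']; congr 1; push_cast; ring
      _ < ‖(Ms : ℚ_[p])‖ * (p : ℝ) ^ (d : ℤ) := by gcongr
  intro h0
  rw [h0, zero_sub, norm_neg] at hdiff
  exact absurd hdiff (not_le.mpr hTgt)

/-- **THE EXACT SPLIT ROW CHECKER in certificate currency**: with the gcd admissibility test,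
`RegMult.CertSplit W p (x, y) 1` (admissible, and the modified height non-zero for every `TateParameterData W p`).
ONE curve per application. [cite: SteinWuthrich2013, §4.2] [cite: SilvermanAEC2009, VII.2.1] [cite: MazurSteinTate2006, §1] -/
theorem certSplit_of_exactSplitRow_padic (hp5 : 5 ≤ p) (W : WeierstrassCurve ℚ) {a₁ a₂ a₃ a₄ a₆ : ℤ}
    (hW : W = ⟨a₁, a₂, a₃, a₄, a₆⟩) [W.IsElliptic] [W.IsGloballyMinimal] (hWm : Mult W p)
    {a b c4 c6 D κn A SL L M b2 Dp U NL B SB LB Den Ms : ℤ} {e' k n N α w ν vL β N' d : ℕ}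
    (Hg : Int.gcd (2 * b + a₁ * a * (p ^ k * e' : ℕ) + a₃ * (p ^ k * e' : ℕ) ^ 3)
        (a₁ * b * (p ^ k * e' : ℕ) - (3 * a ^ 2 + 2 * a₂ * a * (p ^ k * e' : ℕ) ^ 2 + a₄ * (p ^ k * e' : ℕ) ^ 4))
        ∣ (p ^ k * e') ^ n)
    (H₁ : ¬ p ∣ e' ∧ 1 ≤ k ∧ Nat.Coprime a.natAbs (p ^ k * e') ∧
      c4 = (a₁ ^ 2 + 4 * a₂) ^ 2 - 24 * (2 * a₄ + a₁ * a₃) ∧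
      c6 = -(a₁ ^ 2 + 4 * a₂) ^ 3 + 36 * (a₁ ^ 2 + 4 * a₂) * (2 * a₄ + a₁ * a₃) - 216 * (a₃ ^ 2 + 4 * a₆) ∧
      D = -(a₁ ^ 2 + 4 * a₂) ^ 2 * (a₁ ^ 2 * a₆ + 4 * a₂ * a₆ - a₁ * a₃ * a₄ + a₂ * a₃ ^ 2 - a₄ ^ 2) -
        8 * (2 * a₄ + a₁ * a₃) ^ 3 - 27 * (a₃ ^ 2 + 4 * a₆) ^ 2 +
        9 * (a₁ ^ 2 + 4 * a₂) * (2 * a₄ + a₁ * a₃) * (a₃ ^ 2 + 4 * a₆) ∧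
      ¬ (p : ℤ) ∣ c4 ∧ (p : ℤ) ^ k ∣ D ∧
      κn = ((a₁ ^ 2 + 4 * a₂) * (2 * a₄ + a₁ * a₃) - 18 * (a₃ ^ 2 + 4 * a₆)) * c4 ^ 3 + 60 * c6 * D ∧
      (p : ℤ) ^ (4 * k) ∣ a ^ (p - 1) - 1 - A ∧ (p : ℤ) ^ α ∣ A ∧ 1 ≤ α ∧ (N + 1) * p ^ (4 * k) ≤ p ^ ((N + 1) * α) ∧
      (p : ℤ) ^ w ∣ L ∧ ¬ (p : ℤ) ^ (w + 1) ∣ L ∧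
      M = c4 ^ 4 * a * SL + (p - 1 : ℕ) * L * κn * ((p ^ k * e' : ℕ) : ℤ) ^ 2)
    (hSL : (SL : ℚ) = L * ∑ n ∈ Finset.range N, (-1) ^ n * (A : ℚ) ^ (n + 1) / ((n : ℚ) + 1))
    (H₂ : b2 = a₁ ^ 2 + 4 * a₂ ∧ (p : ℤ) ^ ν * Dp = D ∧ ¬ (p : ℤ) ∣ Dp ∧
      U = Dp * c4 ^ 3 + 744 * (p : ℤ) ^ ν * Dp ^ 2 ∧ NL = U ^ (p - 1) - c4 ^ (6 * (p - 1)) ∧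
      (p : ℤ) ^ vL ∣ NL ∧ ¬ (p : ℤ) ^ (vL + 1) ∣ NL ∧ k + vL ≤ ν ∧ vL ≤ 2 * k ∧
      (p : ℤ) ^ (2 * k + 2 * vL) ∣ NL - B * c4 ^ (6 * (p - 1)) ∧ (p : ℤ) ^ β ∣ B ∧ 1 ≤ β ∧
      (N' + 1) * p ^ (2 * k + 2 * vL) ≤ p ^ ((N' + 1) * β) ∧
      Den = (p - 1 : ℕ) * L * c4 ^ 4 * a ^ 3 * 720 * SB ∧ (p : ℤ) ^ d ∣ Den ∧ ¬ (p : ℤ) ^ (d + 1) ∣ Den ∧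
      Ms = M * a ^ 2 * 720 * SB + c6 * (c4 ^ 3 + 744 * (p : ℤ) ^ ν * Dp) *
        (720 * a ^ 2 * ((p ^ k * e' : ℕ) : ℤ) ^ 2 - 60 * b2 * a * ((p ^ k * e' : ℕ) : ℤ) ^ 4 +
          (5 * b2 ^ 2 + 3 * c4) * ((p ^ k * e' : ℕ) : ℤ) ^ 6) * (p - 1 : ℕ) ^ 2 * L * LB ∧
      ¬ (p : ℤ) ^ (4 * k + d) ∣ Ms)
    (hSB : (SB : ℚ) = LB * ∑ n ∈ Finset.range N', (-1) ^ n * (B : ℚ) ^ (n + 1) / ((n : ℚ) + 1))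
    {x y : ℚ} (hx : x = a / ((p ^ k * e' : ℕ) : ℚ) ^ 2) (hy : y = b / ((p ^ k * e' : ℕ) : ℚ) ^ 3)
    (h : W.toAffine.Nonsingular x y) :
    RegMult.CertSplit W p (.some x y h) 1 := by
  have hpP : p.Prime := Fact.out
  have he'0 : e' ≠ 0 := by rintro rfl; exact H₁.1 (dvd_zero p)
  have he0 : (p ^ k * e' : ℕ) ≠ 0 := Nat.mul_ne_zero (pow_ne_zero _ hpP.ne_zero) he'0
  have hpe : p ∣ p ^ k * e' := dvd_mul_of_dvd_left (dvd_pow_self p (by have := H₁.2.1; omega)) _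
  have hx1 : 1 < ‖(x : ℚ_[p])‖ :=
    (one_lt_norm_ratCast_iff p x).mpr (KernelCert.padicValRat_x_neg he0 hx H₁.2.2.1 hpe)
  have hadm : W.IsAdmissible p (.some x y h) :=
    isAdmissible_of_one_lt_norm (by omega) h hx1
      (KernelCert.hasNonsingularReductionAt_of_gcd W hW he0 hx hy H₁.2.2.1 Hg)
  refine ⟨by rw [one_nsmul]; exact hadm, fun Dq => ?_⟩
  rw [one_nsmul]
  show heightSplitCoord W p Dq.q x y ≠ 0
  exact heightSplitCoord_ne_zero_of_exactSplitRow_padic hp5 W hW hWm H₁ hSL H₂ hSB hx h.left Dq.q_ne_zero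
    Dq.norm_q_lt_one Dq.tateJ_eq

end SplitChecker

end Summit.BirchSwinnertonDyer.Rank1Residual.X11b.RegMult.HeightLogNumerator

end
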